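import Summits.CriticalPhenomena.CardyFormulaZ2.Theorems.CardyComplexConeEdgePrecompactEnvelopeFromLocal
import Summits.CriticalPhenomena.CardyFormulaZ2.Theorems.CardyComplexConeEdgePrecompactHalfPlaneArmCubeRoot

/-!
# The necessity certificate in one statement: X1 ⇒ cube-root half-plane one-arm bound (power and log forms)
(line `qkz-strip-boundary-arm` of crux `CardyComplexCone.EdgePrecompact`, stmt-CriticalPhenomena-11387; lead c4;
registered sub-goals `halfPlaneArm_cubeRoot_of_localInnerEnvelopeUI`, `halfPlaneArm_logExponent_le_of_cubeRoot`,
`halfPlaneArm_logExponent_le_of_localInnerEnvelopeUI`)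

Composition of the landed thinning lemma `uniformInnerEnvelope_of_localInnerEnvelopeUI`
(`…EdgePrecompactEnvelopeFromLocal.lean`: the registered open stub X1 `stub_localInnerEnvelopeUI` — verbatim the
hypothesis below — implies `UniformInnerEnvelope`) with the certificate's conclusion
`halfPlaneArm_cubeRoot_of_uniformInnerEnvelope` (`…EdgePrecompactHalfPlaneArmCubeRoot.lean`): ANY proof of the
line's open core X1 yields `P_{1/2}(half-box one-arm at scale n) ≤ C n^{-1/3}` for bond percolation on `ℤ²`.
The open crux `HalfPlaneOneArmThird` (stmt-CriticalPhenomena-5662; same event; in the tree only conditionally on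
the Ikhlef–Ponsaing and DKKMO named facts) is stated logarithmically, `log P(n)/log n → -1/3`; the elementary lemma
`halfPlaneArm_logExponent_le_of_cubeRoot` (power bound ⇒ eventually `log P(n)/log n ≤ -1/3 + ε`, using only the
positivity `P(n) ≥ 2^{-n}` from the straight open path, `real_allOpen`) turns the certificate into exactly the
UPPER HALF of that statement: `halfPlaneArm_logExponent_le_of_localInnerEnvelopeUI`.
-/

namespace Summit.CriticalPhenomena.CardyFormulaZ2.Cruxes.EdgePrecompact.QkzStripBoundaryArm

open MeasureTheory Filter Set Metric
open scoped Topology BigOperators Pointwise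
open Literature.Probability.LatticeModels Literature.Probability.Percolation
open Literature.Probability.RandomPlanarGeometry (DobrushinDomain)
open Summit.CriticalPhenomena.CardyFormulaZ2.Theses.CardyComplexCone

noncomputable section

/-! ## Positivity and the logarithmic form -/

/-- `(0,0)` is the origin. -/
private theorem vsite_zero_L8 : (![0, ((0 : ℕ) : ℤ)] : Site 2) = 0 := by
  ext i; fin_cases i <;> simp

/-- Consecutive axis sites are lattice neighbours. -/
private theorem vsite_adj_L8 (k : ℕ) : (zdGraph 2).Adj ((![0, ((k : ℕ) : ℤ)] : Site 2)) ((![0, ((k + 1 : ℕ) : ℤ)] : Site 2)) := by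
  rw [zdGraph_adj_iff]
  refine ⟨1, Or.inl ?_⟩
  ext i; fin_cases i <;> simp

/-- The axis sites `(0,k)`, `k ≤ n`, lie in the half-box `[-n,n]×[0,n]`. -/
private theorem vsite_mem_L8 {k n : ℕ} (hk : k ≤ n) :
    (![0, ((k : ℕ) : ℤ)] : Site 2) ∈ {v : Site 2 | 0 ≤ v 1 ∧ -(n : ℤ) ≤ v 0 ∧ v 0 ≤ n ∧ v 1 ≤ n} := by
  simp only [mem_setOf_eq, Matrix.cons_val_one, Matrix.cons_val_zero, Matrix.cons_val_fin_one]
  omega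

/-- **Positivity of the half-plane one-arm probability**: `P(n) ≥ 2^{-n} > 0` (open the `n` edges of the
vertical segment from `0` to `(0,n)`). -/
theorem halfPlaneArm_pos (n : ℕ) :
    0 < (bondPercolation (zdGraph 2) half).real {ω : BondConfig (Site 2) | ∃ y : Site 2,
      (y 0 = (n : ℤ) ∨ y 0 = -(n : ℤ) ∨ y 1 = (n : ℤ)) ∧
      ω ∈ openConnIn {v : Site 2 | 0 ≤ v 1 ∧ -(n : ℤ) ≤ v 0 ∧ v 0 ≤ n ∧ v 1 ≤ n} 0 y} := by
  set S : Set (Site 2) := {v : Site 2 | 0 ≤ v 1 ∧ -(n : ℤ) ≤ v 0 ∧ v 0 ≤ n ∧ v 1 ≤ n} with hS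
  set K : Finset (Sym2 (Site 2)) := (Finset.range n).image fun k => s((![0, ((k : ℕ) : ℤ)] : Site 2), (![0, ((k + 1 : ℕ) : ℤ)] : Site 2)) with hK
  have hKE : ∀ e ∈ K, e ∈ (zdGraph 2).edgeSet := by
    intro e he
    obtain ⟨k, -, rfl⟩ := Finset.mem_image.1 he
    exact (SimpleGraph.mem_edgeSet _).2 (vsite_adj_L8 k)
  have hpos : 0 < (bondPercolation (zdGraph 2) half).real {ω : BondConfig (Site 2) | ∀ e ∈ K, e ∈ ω} := by
    rw [real_allOpen K hKE]; positivity
  refine hpos.trans_le (measureReal_mono ?_)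
  intro ω hω
  -- the straight path is open: reachability inside `S` by induction along the axis
  have hreach : ∀ (k : ℕ) (hk : k ≤ n), ((openGraph ω).induce S).Reachable ⟨(![0, ((0 : ℕ) : ℤ)] : Site 2), vsite_mem_L8 (Nat.zero_le n)⟩
      ⟨(![0, ((k : ℕ) : ℤ)] : Site 2), vsite_mem_L8 hk⟩ := by
    intro k hk
    induction k with
    | zero => exact SimpleGraph.Reachable.refl _
    | succ k ih =>
      have hk' : k ≤ n := Nat.le_of_succ_le hk
      refine (ih hk').trans (SimpleGraph.Adj.reachable ?_)
      simp only [SimpleGraph.induce, SimpleGraph.comap_adj, Function.Embedding.coe_subtype, openGraph_adj]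
      refine ⟨hω _ (Finset.mem_image.2 ⟨k, Finset.mem_range.2 (Nat.lt_of_succ_le hk), rfl⟩), ?_⟩
      exact (vsite_adj_L8 k).ne
  refine ⟨(![0, ((n : ℕ) : ℤ)] : Site 2), Or.inr (Or.inr (by simp)), ?_⟩
  have key : ∀ (x : Site 2), x = (![0, ((0 : ℕ) : ℤ)] : Site 2) → ω ∈ openConnIn S x ((![0, ((n : ℕ) : ℤ)] : Site 2)) := by
    intro x hx
    subst hx
    exact ⟨vsite_mem_L8 (Nat.zero_le n), vsite_mem_L8 le_rfl, hreach n le_rfl⟩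
  exact key 0 vsite_zero_L8.symm

/-- **From the cube-root power bound to the logarithmic exponent bound (registered sub-goal
`halfPlaneArm_logExponent_le_of_cubeRoot`).** If `P(n) ≤ C n^{-1/3}` for all `n ≥ 1`, then for every `ε > 0`,
eventually `log P(n) / log n ≤ -1/3 + ε` — the upper half of `HalfPlaneOneArmThird`'s `log P(n)/log n → -1/3`. -/
theorem halfPlaneArm_logExponent_le_of_cubeRoot :
    (∃ C : ℝ, ∀ n : ℕ, 1 ≤ n → (bondPercolation (zdGraph 2) half).real {ω : BondConfig (Site 2) | ∃ y : Site 2,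
      (y 0 = (n : ℤ) ∨ y 0 = -(n : ℤ) ∨ y 1 = (n : ℤ)) ∧
      ω ∈ openConnIn {v : Site 2 | 0 ≤ v 1 ∧ -(n : ℤ) ≤ v 0 ∧ v 0 ≤ n ∧ v 1 ≤ n} 0 y} ≤ C * (n : ℝ) ^ (-(1 : ℝ) / 3)) →
    ∀ ε > (0:ℝ), ∀ᶠ n : ℕ in atTop, Real.log ((bondPercolation (zdGraph 2) half).real {ω : BondConfig (Site 2) |
      ∃ y : Site 2, (y 0 = (n : ℤ) ∨ y 0 = -(n : ℤ) ∨ y 1 = (n : ℤ)) ∧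
      ω ∈ openConnIn {v : Site 2 | 0 ≤ v 1 ∧ -(n : ℤ) ≤ v 0 ∧ v 0 ≤ n ∧ v 1 ≤ n} 0 y}) / Real.log n ≤
      -(1 / 3 : ℝ) + ε := by
  rintro ⟨C, hC⟩ ε hε
  -- `P(1) ≤ C` forces `C > 0`
  have hC0 : 0 < C := by
    have h1 := hC 1 le_rfl
    simp only [Nat.cast_one, Real.one_rpow, mul_one] at h1
    exact (halfPlaneArm_pos 1).trans_le h1
  -- eventually `log C / log n ≤ ε`, i.e. `n ≥ exp (log C / ε)` and `n ≥ 2`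
  have hev : ∀ᶠ n : ℕ in atTop, Real.log C ≤ ε * Real.log n ∧ (2 : ℝ) ≤ n := by
    have h1 : Tendsto (fun n : ℕ => Real.log (n : ℝ)) atTop atTop :=
      Real.tendsto_log_atTop.comp tendsto_natCast_atTop_atTop
    have h2 : ∀ᶠ n : ℕ in atTop, Real.log C / ε ≤ Real.log (n : ℝ) := h1.eventually_ge_atTop _
    have h3 : ∀ᶠ n : ℕ in atTop, (2 : ℝ) ≤ n := by
      filter_upwards [eventually_ge_atTop 2] with n hn; exact_mod_cast hn
    filter_upwards [h2, h3] with n hn h2n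
    exact ⟨by rwa [div_le_iff₀ hε, mul_comm] at hn, h2n⟩
  filter_upwards [hev] with n hn
  obtain ⟨hlogC, h2n⟩ := hn
  have hn1 : 1 ≤ n := by exact_mod_cast (show (1:ℝ) ≤ n by linarith)
  have hlogn : 0 < Real.log (n : ℝ) := Real.log_pos (by linarith)
  have hP := hC n hn1
  have hPpos := halfPlaneArm_pos n
  -- `log P ≤ log C - (1/3) log n`
  have hlogP : Real.log ((bondPercolation (zdGraph 2) half).real {ω : BondConfig (Site 2) | ∃ y : Site 2,
      (y 0 = (n : ℤ) ∨ y 0 = -(n : ℤ) ∨ y 1 = (n : ℤ)) ∧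
      ω ∈ openConnIn {v : Site 2 | 0 ≤ v 1 ∧ -(n : ℤ) ≤ v 0 ∧ v 0 ≤ n ∧ v 1 ≤ n} 0 y}) ≤
      Real.log C + (-(1:ℝ) / 3) * Real.log n := by
    have h := Real.log_le_log hPpos hP
    rwa [Real.log_mul hC0.ne' (Real.rpow_pos_of_pos (by positivity) _).ne',
      Real.log_rpow (by positivity)] at h
  rw [div_le_iff₀ hlogn]
  nlinarith

/-! ## The certificate in one statement -/

/-- **X1 ⇒ the sharp cube-root upper bound for the half-plane one-arm probability of bond-ℤ²** (registered
sub-goal `halfPlaneArm_cubeRoot_of_localInnerEnvelopeUI`; hypothesis = the registered stub `stub_localInnerEnvelopeUI`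
verbatim, conclusion = that of `halfPlaneArm_cubeRoot_of_uniformInnerEnvelope`). -/
theorem halfPlaneArm_cubeRoot_of_localInnerEnvelopeUI : (∀ ε₁ > (0:ℝ), ∃ ε' > (0:ℝ), ∀ (E : DiscreteDobrushin), E.IsZdAdmissible → ∀ v f : Site 2, IsCorner v f → ∀ ρ : ℝ, E.δ ≤ ρ → closedBall (meshPoint E.δ v) ρ ⊆ E.Ω → ∀ A : Set (BondConfig (Site 2)), MeasurableSet[MeasurableSpace.comap (fun ω : BondConfig (Site 2) => ω \ {e | medialPoint E.δ e ∈ ball (meshPoint E.δ v) ρ}) (inferInstance : MeasurableSpace (BondConfig (Site 2)))] A → (bondPercolation (zdGraph 2) half).real A ≤ ε' → ‖∫ ω in A, dartPhaseSum (medialExploration E ω) E.δ (1 / 3) (v, f) ∂(bondPercolation (zdGraph 2) half)‖ ≤ ε₁ * (E.δ / ρ) ^ ((1:ℝ) / 3)) → ∃ C : ℝ, ∀ n : ℕ, 1 ≤ n → (bondPercolation (zdGraph 2) half).real {ω : BondConfig (Site 2) | ∃ y : Site 2, (y 0 = (n : ℤ) ∨ y 0 = -(n : ℤ) ∨ y 1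 = (n : ℤ)) ∧ ω ∈ openConnIn {v : Site 2 | 0 ≤ v 1 ∧ -(n : ℤ) ≤ v 0 ∧ v 0 ≤ n ∧ v 1 ≤ n} 0 y} ≤ C * (n : ℝ) ^ (-(1 : ℝ) / 3) :=
  fun h => halfPlaneArm_cubeRoot_of_uniformInnerEnvelope (uniformInnerEnvelope_of_localInnerEnvelopeUI h)

/-- **`UniformInnerEnvelope` ⇒ the upper half of `HalfPlaneOneArmThird` in its logarithmic form**:
eventually `log P(n) / log n ≤ -1/3 + ε`. -/
theorem halfPlaneArm_logExponent_le_of_uniformInnerEnvelope :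
    UniformInnerEnvelope → ∀ ε > (0:ℝ), ∀ᶠ n : ℕ in atTop, Real.log ((bondPercolation (zdGraph 2) half).real {ω : BondConfig (Site 2) | ∃ y : Site 2, (y 0 = (n : ℤ) ∨ y 0 = -(n : ℤ) ∨ y 1 = (n : ℤ)) ∧ ω ∈ openConnIn {v : Site 2 | 0 ≤ v 1 ∧ -(n : ℤ) ≤ v 0 ∧ v 0 ≤ n ∧ v 1 ≤ n} 0 y}) / Real.log n ≤ -(1 / 3 : ℝ) + ε :=
  fun h => halfPlaneArm_logExponent_le_of_cubeRoot (halfPlaneArm_cubeRoot_of_uniformInnerEnvelope h)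

/-- **X1 ⇒ the upper half of `HalfPlaneOneArmThird` in its logarithmic form** (registered sub-goal
`halfPlaneArm_logExponent_le_of_localInnerEnvelopeUI`; hypothesis = `stub_localInnerEnvelopeUI` verbatim). -/
theorem halfPlaneArm_logExponent_le_of_localInnerEnvelopeUI : (∀ ε₁ > (0:ℝ), ∃ ε' > (0:ℝ), ∀ (E : DiscreteDobrushin), E.IsZdAdmissible → ∀ v f : Site 2, IsCorner v f → ∀ ρ : ℝ, E.δ ≤ ρ → closedBall (meshPoint E.δ v) ρ ⊆ E.Ω → ∀ A : Set (BondConfig (Site 2)), MeasurableSet[MeasurableSpace.comap (fun ω : BondConfig (Site 2) => ω \ {e | medialPoint E.δ e ∈ ball (meshPoint E.δ v) ρ}) (inferInstance : MeasurableSpace (BondConfig (Site 2)))] A → (bondPercolation (zdGraph 2) half).real A ≤ ε' → ‖∫ ω in A, dartPhaseSum (medialExploration E ω) E.δ (1 / 3) (v, f) ∂(bondPercolation (zdGraph 2) half)‖ ≤ ε₁ * (E.δ / ρ) ^ ((1:ℝ) / 3)) → ∀ ε > (0:ℝ), ∀ᶠ n : ℕ in atTop, Real.log ((bondPercolation (zdGraph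 2) half).real {ω : BondConfig (Site 2) | ∃ y : Site 2, (y 0 = (n : ℤ) ∨ y 0 = -(n : ℤ) ∨ y 1 = (n : ℤ)) ∧ ω ∈ openConnIn {v : Site 2 | 0 ≤ v 1 ∧ -(n : ℤ) ≤ v 0 ∧ v 0 ≤ n ∧ v 1 ≤ n} 0 y}) / Real.log n ≤ -(1 / 3 : ℝ) + ε :=
  fun h => halfPlaneArm_logExponent_le_of_uniformInnerEnvelope (uniformInnerEnvelope_of_localInnerEnvelopeUI h)

end

end Summit.CriticalPhenomena.CardyFormulaZ2.Cruxes.EdgePrecompact.QkzStripBoundaryArm
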